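import Summits.QuantumFields.YangMills.Theorems.NPointIsotropy.Negative.ModelBlindFalse
import Summits.QuantumFields.YangMills.Theorems.CurvatureBoostCovariance.Negative.VacuumSharp
import Literature.MathematicalPhysics.QuantumLattice.GaugeGroupsProofs

/-!
# Negative results on `PencilRigidity.NPointIsotropy`, V: the crux unbundled; the lattice TIE AT ORDER 4 is the
load-bearing clause; the hypothesis set is inhabited with the radial kernel

Fifth file of the standing disprover's analysis of crux stmt-QuantumFields-11686 (refuter, cdisprove, cycle 2).
Everything is stated over tree objects; the unbundling predicates `W1`, `Tie`, `OSPackage`, `Translations`,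
`Hypercubic`, `Gaps`, `EightFrameRP`, `PlanarInvariant` are the LANDED ones of the sibling crux
`MirrorModularBoosts.CurvatureBoostCovariance` (same curvature package `W₁`, same eight frames, same conclusion;
only the planar cone is replaced by the radial two-point kernel `RadialKernel`).

* `nPointIsotropy_iff` (definitional): the crux is
  `∀ G …, W1 r sch S₁ → EightFrameRP S₁ → RadialKernel S₁ → PlanarInvariant S₁`.
* `hypotheses_vac_radial`: for EVERY compact group `G` and EVERY lattice representation `r` the zero scheme and the
  vacuum family satisfy `W1 ∧ EightFrameRP ∧ RadialKernel` (with `K = 0`) and the conclusion — the hypothesis set of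
  the crux is jointly satisfiable, the crux is neither vacuous nor junk-refutable through `K`.
* `NPointIsotropyWithoutTieAt4`: the crux with the Wilson-convergence clause (the TIE) required at every order
  `n ≠ 4` but NOT at `n = 4` — the lattice gap `HasLatticeMassGap`, the continuum gap and every other clause kept
  verbatim. `not_NPointIsotropyWithoutTieAt4` REFUTES it: `G = SU(2)`, the fundamental representation, the zero
  scheme (`β ≡ 0`, so `HasLatticeMassGap` holds for every `Δ` by the landed `hasLatticeMassGap_of_zero_coupling`;
  `c ≡ 0`, so every lattice string vanishes and the junk family of file II, which vanishes in every degree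
  `∉ {0, 4}`, IS tied at every order `≠ 4`), `S₁ = junk`, `K = 0`; the conclusion fails at `n = 4`
  (`not_conclusionOf_junk`, file IV).
* Corollaries `not_NPointIsotropyWithoutTie` (drop the whole tie, keep both gaps) and the chain
  `ModelBlind → WithoutTie → WithoutTieAt4 → crux`: cycle 1's `not_NPointIsotropyModelBlind` dropped BOTH lattice
  clauses; the present file shows that the lattice GAP is not what saves the crux from junk — the tie is, and
  order by order: ANY PROOF of planar invariance of `𝔖₄` must use the convergence of the lattice FOUR-point
  functions of `tr F²` themselves (not only `n ≤ 3`, not only the gaps, not only `K`).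
* `NPointIsotropyWithoutLatticeGap → NPointIsotropy` is recorded (`nPointIsotropy_of_withoutLatticeGap`); that
  weakening is NOT cheaply refutable (a tied anisotropic family is a genuine Wilson scaling limit; see the work
  file `Cruxes/NPointIsotropy/Disproof.lean` §7) — information for provers: `HasLatticeMassGap` is possibly
  unnecessary for the n-point step.
-/

noncomputable section

-- Mathlib's `SimplexCategory` instance `Fintype (Fin (x.len + 1))` matches `Fintype (Fin 4)` and makes concrete
-- `Fin 4` instance paths diverge between elaborations (tree-known workaround, cf. files I–IV).
attribute [-instance] SimplexCategory.instFintypeToTypeOrderHomFinHAddNatLenOfNat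

namespace Summit.QuantumFields.YangMills.Theorems.NPointIsotropy.Negative

open scoped BigOperators SchwartzMap
open MeasureTheory Filter Topology
open Literature.MathematicalPhysics.QuantumLattice Literature.MathematicalPhysics.AQFT
  Literature.MathematicalPhysics.QuantumFieldTheory
open Summit.QuantumFields.YangMills.Theorems.CurvatureBoostCovariance.Negative
  (OSPackage Translations Hypercubic EightFrameRP PlanarInvariant Tie Gaps W1 vac
    hypotheses_vac vac_of_ne_zero latticeSchwinger_eq_zero_of_c_eq_zero)

/-! ## §1 The crux unbundled -/

/-- **The radial-kernel hypothesis** of the crux (verbatim): the two-point function on `⁰𝒮` is integration against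
a real kernel `K(x₀ − x₁)`, continuous off `0` and invariant under every linear isometry off `0`. -/
def RadialKernel (S₁ : SchwingerFamily E4) : Prop :=
  ∃ K : E4 → ℝ, ContinuousOn K {x : E4 | x ≠ 0} ∧ (∀ (R : E4 ≃ₗᵢ[ℝ] E4) (x : E4), x ≠ 0 → K (R x) = K x) ∧
    ∀ F : 𝓢((Fin 2 → E4), ℂ), IsOffDiagonal F →
      MeasureTheory.Integrable (fun x : Fin 2 → E4 => (K (x 0 - x 1) : ℂ) * F x) ∧
      S₁ 2 F = ∫ x : Fin 2 → E4, (K (x 0 - x 1) : ℂ) * F x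

/-- **§1a. The crux, unbundled** (definitional): for every compact simple `G` (Borel σ-algebra),
`W1 r sch S₁ → EightFrameRP S₁ → RadialKernel S₁ → PlanarInvariant S₁`. [folklore] -/
theorem nPointIsotropy_iff :
    Summit.QuantumFields.YangMills.Theses.PencilRigidity.NPointIsotropy ↔
      ∀ (G : Type) [Group G] [TopologicalSpace G] [IsTopologicalGroup G] [CompactSpace G],
        IsCompactSimpleLieGroup G →
        letI : MeasurableSpace G := borel G
        haveI : BorelSpace G := ⟨rfl⟩
        ∀ (r : LatticeRep G) (sch : SpeciesScheme (YMSpecies G)) (S₁ : SchwingerFamily E4),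
          W1 r sch S₁ → EightFrameRP S₁ → RadialKernel S₁ → PlanarInvariant S₁ :=
  Iff.rfl

/-- A family vanishing on `⁰𝒮` in degree `2` has the radial kernel `K = 0`. [folklore] -/
theorem radialKernel_of_two_eq_zero (S₁ : SchwingerFamily E4)
    (h : ∀ F : 𝓢((Fin 2 → E4), ℂ), IsOffDiagonal F → S₁ 2 F = 0) : RadialKernel S₁ :=
  ⟨fun _ => 0, continuousOn_const, fun _ _ _ => rfl, fun F hF => ⟨by simp, by simp [h F hF]⟩⟩

/-- The vacuum family has the radial kernel `K = 0`. [folklore] -/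
theorem radialKernel_vac : RadialKernel vac :=
  radialKernel_of_two_eq_zero _ fun F _ => by rw [vac_of_ne_zero two_ne_zero]; rfl

/-- The junk family of file II has the radial kernel `K = 0` (`𝔖₂ = 0`). [folklore] -/
theorem radialKernel_junk : RadialKernel junk :=
  radialKernel_of_two_eq_zero _ fun F _ => by
    rw [junk_of_ne (show (2 : ℕ) ≠ 0 by decide) (show (2 : ℕ) ≠ 4 by decide)]; rfl

section NonVacuity

variable {G : Type} [Group G] [TopologicalSpace G] [IsTopologicalGroup G] [CompactSpace G]
  [MeasurableSpace G] [BorelSpace G]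

/-- **§1b. NON-VACUITY of the whole hypothesis set of the crux.** For EVERY compact group `G` and EVERY lattice
representation `r`, the zero scheme and the vacuum family satisfy `W₁`, the eight-frame RP and the radial-kernel
hypothesis (with `K = 0`), and the conclusion. So the crux is not vacuous, and no refutation can come from the
kernel clause alone. [folklore] -/
theorem hypotheses_vac_radial (r : LatticeRep G) :
    W1 r (SpeciesScheme.zero _) vac ∧ EightFrameRP vac ∧ RadialKernel vac ∧ PlanarInvariant vac := by
  obtain ⟨hW, h8, -, hP⟩ := hypotheses_vac r
  exact ⟨hW, h8, radialKernel_vac, hP⟩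

end NonVacuity

/-! ## §2 Weakenings of the hypothesis set, and which of them the junk family reaches -/

/-- **The crux without the tie AT ORDER 4**: the Wilson-convergence clause is required for every `n ≠ 0` with
`n ≠ 4`, and every other clause of `W₁` (OS package, translations, proper hypercubic invariance, continuum gap AND
the uniform lattice gap `HasLatticeMassGap r sch Δ`) is kept verbatim, as are the eight-frame RP and the radial
kernel. Refuted below. -/
def NPointIsotropyWithoutTieAt4 : Prop :=
  ∀ (G : Type) [Group G] [TopologicalSpace G] [IsTopologicalGroup G] [CompactSpace G],
    IsCompactSimpleLieGroup G →
    letI : MeasurableSpace G := borel G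
    haveI : BorelSpace G := ⟨rfl⟩
    ∀ (r : LatticeRep G) (sch : SpeciesScheme (YMSpecies G)) (S₁ : SchwingerFamily E4),
      ((∀ (n : ℕ), n ≠ 0 → n ≠ 4 → ∀ (f : Fin n → 𝓢(E4, ℝ)) (F : 𝓢((Fin n → E4), ℂ)),
          IsTensorOf F (fun i => ofRealTest (f i)) → IsOffDiagonal F →
            Tendsto (fun k : ℕ => ((latticeSchwinger r.ρ sch (fun s => s.F) k n
              (fun _ => r.curvature) f : ℝ) : ℂ)) atTop (𝓝 (S₁ n F))) ∧
        OSPackage S₁ ∧ Translations S₁ ∧ Hypercubic S₁ ∧ Gaps r sch S₁) →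
      EightFrameRP S₁ → RadialKernel S₁ → PlanarInvariant S₁

/-- **The crux without the tie** (all orders dropped; both gaps, in particular `HasLatticeMassGap`, kept). -/
def NPointIsotropyWithoutTie : Prop :=
  ∀ (G : Type) [Group G] [TopologicalSpace G] [IsTopologicalGroup G] [CompactSpace G],
    IsCompactSimpleLieGroup G →
    letI : MeasurableSpace G := borel G
    haveI : BorelSpace G := ⟨rfl⟩
    ∀ (r : LatticeRep G) (sch : SpeciesScheme (YMSpecies G)) (S₁ : SchwingerFamily E4),
      (OSPackage S₁ ∧ Translations S₁ ∧ Hypercubic S₁ ∧ Gaps r sch S₁) →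
      EightFrameRP S₁ → RadialKernel S₁ → PlanarInvariant S₁

/-- **The crux without the uniform lattice gap** (`HasLatticeMassGap` dropped, the tie and the continuum gap kept).
NOT refuted here: a tied family is a Wilson scaling limit of the `tr F²` strings on `⁰𝒮`-tensors, and no scheme we
can certify ties an anisotropic one (work file §7). Recorded so that provers know the lattice gap is possibly
unnecessary for the n-point step. -/
def NPointIsotropyWithoutLatticeGap : Prop :=
  ∀ (G : Type) [Group G] [TopologicalSpace G] [IsTopologicalGroup G] [CompactSpace G],
    IsCompactSimpleLieGroup G →
    letI : MeasurableSpace G := borel G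
    haveI : BorelSpace G := ⟨rfl⟩
    ∀ (r : LatticeRep G) (sch : SpeciesScheme (YMSpecies G)) (S₁ : SchwingerFamily E4),
      (Tie r sch S₁ ∧ OSPackage S₁ ∧ Translations S₁ ∧ Hypercubic S₁ ∧
          ∃ Δ : ℝ, 0 < Δ ∧ S₁.toLabelled.HasMassGap Δ) →
      EightFrameRP S₁ → RadialKernel S₁ → PlanarInvariant S₁

/-- `WithoutTieAt4` implies the crux (forget the tie at order 4). [folklore] -/
theorem nPointIsotropy_of_withoutTieAt4 (h : NPointIsotropyWithoutTieAt4) :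
    Summit.QuantumFields.YangMills.Theses.PencilRigidity.NPointIsotropy := by
  rw [nPointIsotropy_iff]
  intro G _ _ _ _ hG r sch S₁ hW h8 hK
  exact h G hG r sch S₁ ⟨fun n hn _ f F hF hF' => hW.1 n hn f F hF hF', hW.2⟩ h8 hK

/-- `WithoutTie` implies `WithoutTieAt4` (forget the remaining orders of the tie). [folklore] -/
theorem withoutTieAt4_of_withoutTie (h : NPointIsotropyWithoutTie) : NPointIsotropyWithoutTieAt4 := by
  intro G _ _ _ _ hG r sch S₁ hW h8 hK
  exact h G hG r sch S₁ hW.2 h8 hK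

/-- The model-blind form of file IV implies `WithoutTie` (forget `G`, `r`, `sch` and the lattice gap). [folklore] -/
theorem withoutTie_of_modelBlind (h : NPointIsotropyModelBlind) : NPointIsotropyWithoutTie := by
  intro G _ _ _ _ hG r sch S₁ hW h8 hK
  obtain ⟨hOS, htr, hhyp, Δ, hΔ, hgap, -⟩ := hW
  exact h S₁ ⟨hOS, htr, hhyp, Δ, hΔ, hgap⟩ h8 hK

/-- `WithoutLatticeGap` implies the crux (forget `HasLatticeMassGap`). [folklore] -/
theorem nPointIsotropy_of_withoutLatticeGap (h : NPointIsotropyWithoutLatticeGap) :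
    Summit.QuantumFields.YangMills.Theses.PencilRigidity.NPointIsotropy := by
  rw [nPointIsotropy_iff]
  intro G _ _ _ _ hG r sch S₁ hW h8 hK
  obtain ⟨htie, hOS, htr, hhyp, Δ, hΔ, hgap, -⟩ := hW
  exact h G hG r sch S₁ ⟨htie, hOS, htr, hhyp, Δ, hΔ, hgap⟩ h8 hK

/-! ## §3 The tie at order 4 is load-bearing -/

section JunkLattice

variable {G : Type} [Group G] [TopologicalSpace G] [IsTopologicalGroup G] [CompactSpace G]
  [MeasurableSpace G] [BorelSpace G]

/-- **The junk family is tied at every order `n ≠ 4` to every scheme with `c_k = 0` on the curvature** (e.g. the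
zero scheme): both sides vanish (`𝔖ₙ = 0` for `n ∉ {0, 4}`; every lattice string carries the factor `c_k = 0`).
[folklore] -/
theorem junk_tie_of_ne_four (r : LatticeRep G) (sch : SpeciesScheme (YMSpecies G))
    (hc : ∀ k, sch.c r.curvature k = 0) {n : ℕ} (hn : n ≠ 0) (h4 : n ≠ 4) (f : Fin n → 𝓢(E4, ℝ))
    (F : 𝓢((Fin n → E4), ℂ)) :
    Tendsto (fun k : ℕ => ((latticeSchwinger r.ρ sch (fun s => s.F) k n (fun _ => r.curvature) f : ℝ) : ℂ))
      atTop (𝓝 (junk n F)) := by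
  have h0 : ∀ k, ((latticeSchwinger r.ρ sch (fun s => s.F) k n (fun _ => r.curvature) f : ℝ) : ℂ) = 0 :=
    fun k => by rw [latticeSchwinger_eq_zero_of_c_eq_zero r sch hc k hn, Complex.ofReal_zero]
  simp only [h0, junk_of_ne hn h4]
  exact tendsto_const_nhds

/-- **The junk family satisfies every hypothesis of `WithoutTieAt4`** over any `G`, any `r` and the zero scheme:
the tie at all orders `≠ 4`, the OS package, translations, proper hypercubic invariance, both gaps with `Δ = 1`
(`HasLatticeMassGap` by `β ≡ 0`), RP in the eight frames, and the radial kernel `K = 0`. [folklore] -/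
theorem junk_hypotheses_withoutTieAt4 (r : LatticeRep G) :
    ((∀ (n : ℕ), n ≠ 0 → n ≠ 4 → ∀ (f : Fin n → 𝓢(E4, ℝ)) (F : 𝓢((Fin n → E4), ℂ)),
        IsTensorOf F (fun i => ofRealTest (f i)) → IsOffDiagonal F →
          Tendsto (fun k : ℕ => ((latticeSchwinger r.ρ (SpeciesScheme.zero (YMSpecies G)) (fun s => s.F) k n
            (fun _ => r.curvature) f : ℝ) : ℂ)) atTop (𝓝 (junk n F))) ∧
      OSPackage junk ∧ Translations junk ∧ Hypercubic junk ∧ Gaps r (SpeciesScheme.zero (YMSpecies G)) junk) ∧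
    EightFrameRP junk ∧ RadialKernel junk :=
  ⟨⟨fun _ hn h4 f F _ _ => junk_tie_of_ne_four r _ (fun _ => rfl) hn h4 f F,
    ⟨junk_isNormalized, junk_isHermitian, junk_hasLinearGrowth, junk_rp, junk_isSymmetric,
      junk_hasClusterProperty⟩,
    fun n a F _ => junk_translate n a F,
    fun _ _ hR n F _ => junk_hyper n hR F,
    ⟨1, one_pos, junk_hasMassGap 1,
      Theorems.LatticeGapOnTrajectory.Negative.hasLatticeMassGap_of_zero_coupling r _ (fun _ => rfl) 1⟩⟩,
    fun R a b _ _ hR => junk_frame_rp R a b hR, radialKernel_junk⟩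

end JunkLattice

/-- **Theorem (the tie at order 4 is load-bearing).** `NPointIsotropyWithoutTieAt4` is false: `G = SU(2)`, the
fundamental representation, the zero scheme, `S₁ = junk`, `K = 0`; every hypothesis holds
(`junk_hypotheses_withoutTieAt4`) and `𝔖₄(R₀ · F₀) = 0 ≠ 𝔖₄(F₀)` (`not_conclusionOf_junk`). Hence any proof of
the crux must use the convergence of the lattice FOUR-point functions of the curvature at order 4 itself.
[folklore] -/
theorem not_NPointIsotropyWithoutTieAt4 : ¬ NPointIsotropyWithoutTieAt4 := by
  intro h
  have hG : IsCompactSimpleLieGroup (Matrix.specialUnitaryGroup (Fin 2) ℂ) :=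
    isCompactSimpleLieGroup_specialUnitaryGroup isSimpleCompactGroup_specialUnitaryGroup_holds le_rfl
  letI : MeasurableSpace (Matrix.specialUnitaryGroup (Fin 2) ℂ) := borel _
  haveI : BorelSpace (Matrix.specialUnitaryGroup (Fin 2) ℂ) := ⟨rfl⟩
  let r : LatticeRep (Matrix.specialUnitaryGroup (Fin 2) ℂ) :=
    ⟨2, fundamentalRep (Fin 2), continuous_fundamentalRep _, fundamentalRep_injective _,
      fundamentalRep_mem_unitaryGroup⟩
  obtain ⟨hW, h8, hK⟩ := junk_hypotheses_withoutTieAt4 r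
  exact not_conclusionOf_junk (h (Matrix.specialUnitaryGroup (Fin 2) ℂ) hG r (SpeciesScheme.zero _) junk hW h8 hK)

/-- **Corollary (the whole tie is load-bearing; the lattice gap does not rescue the model-blind form).**
[folklore] -/
theorem not_NPointIsotropyWithoutTie : ¬ NPointIsotropyWithoutTie :=
  fun h => not_NPointIsotropyWithoutTieAt4 (withoutTieAt4_of_withoutTie h)

-- (Cycle 1's `not_NPointIsotropyModelBlind` (file IV) is recovered as
-- `fun h => not_NPointIsotropyWithoutTie (withoutTie_of_modelBlind h)`.)

end Summit.QuantumFields.YangMills.Theorems.NPointIsotropy.Negative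

end
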